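import Literature.AlgebraicGeometry.Limits.LocalizationIsoSpread
import HarnessLib

/-!
# Limits of schemes: quasi-compact opens and stages of `P ×_A Spec A_S = lim_s P ×_A Spec A[1/s]`

Topic: `Literature/AlgebraicGeometry/Limits`; sixth file on the localization diagram
(`Limits/LocalizationDiagram`, `Limits/LocalizationProdLimit`, `Limits/LocalizationIsoSpread`,
`Limits/LocalizationSmoothSpread`, `Limits/LocalizationSeparatedSpread`). Bookkeeping for the
descent of schemes of finite presentation along `Spec A_S = lim Spec A[1/s]` (EGA IV₃ 8.8.2 (ii),
Stacks 01ZM, carried out in `Limits/LocalizationTwoOpensDescent` and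
`Limits/LocalizationSchemeDescent`):

* `isPullback_whiskerRight_left`, `isPullback_whiskerLeft_whiskerRight_left`,
  `range_whiskerRight_left`, `range_whiskerRight_left_eq_preimage` — for `f : Q → P` over a base
  and `T' → T`, the squares `Q ⊗ T → P ⊗ T` over `Q → P` and `Q ⊗ T' → P ⊗ T'` over
  `Q ⊗ T → P ⊗ T` are cartesian, so the range of `f ⊗ T'` is the preimage of the range of `f ⊗ T`;
* `hom_eq_of_mono_hom` — morphisms into an object of `Over X` with monic structure map are unique
  (applied to the open stages `Spec A[1/s] → Spec A`);
* `toStage`, `stageIso`, `whiskerRight_toStage` — the canonical isomorphism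
  `P ⊗ Spec B ≅ (P ⊗ Spec A[1/s]) ⊗ Spec B` over `Spec A` (`B = A_S`), natural in `P`;
* `exists_isCompact_preimage_eq`, `exists_isCompact_preimage_eq₂` — a quasi-compact open subset
  of `P ×_A Spec B = lim_s P ×_A Spec A[1/s]` is the preimage of a quasi-compact open subset of a
  stage, and two such (for two schemes `P₁`, `P₂`) come from a common stage
  (Mathlib `exists_preimage_eq`, Stacks 01Z4 (1), applied to `LocApprox.isLimitProdCone`).

## References

* The Stacks project, Tags 01Z4, 01ZM. [StacksProject]
* A. Grothendieck, EGA IV₃, §8.2, Thm. 8.8.2 (Publ. Math. IHÉS 28, 1966). [EGAIV3]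
* U. Görtz, T. Wedhorn, *Algebraic Geometry I: Schemes*, 2nd ed. (2020), (10.13), Thm. 10.57.
  [GortzWedhorn2020]
-/

noncomputable section

universe u

open CategoryTheory CategoryTheory.Limits AlgebraicGeometry TopologicalSpace MonoidalCategory
  CartesianMonoidalCategory
open Opposite

namespace Literature.AlgebraicGeometry.Limits

namespace LocApprox

open Literature.AlgebraicGeometry.Motives (SchemeOver specOver)

set_option backward.isDefEq.respectTransparency false

/-! ## Cartesian squares attached to `f ⊗ T` -/

section Squares

variable {X : Scheme.{u}} {Q P : Over X} (f : Q ⟶ P) (T : Over X) {T' : Over X} (g : T' ⟶ T)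

/-- **`(Q ⊗ T).left → (P ⊗ T).left` is the base change of `Q.left → P.left`** along the first
projection `(P ⊗ T).left → P.left`. [folklore] -/
theorem isPullback_whiskerRight_left :
    IsPullback (f ▷ T).left (pullback.fst Q.hom T.hom) (pullback.fst P.hom T.hom) f.left := by
  refine IsPullback.of_right ?_ (Over.whiskerRight_left_fst f) (IsPullback.of_hasPullback P.hom T.hom).flip
  rw [Over.whiskerRight_left_snd, Over.w f]
  exact (IsPullback.of_hasPullback Q.hom T.hom).flip

/-- The range of `(Q ⊗ T).left → (P ⊗ T).left` is the preimage of the range of `Q.left → P.left`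
under the first projection. [folklore] -/
theorem range_whiskerRight_left :
    Set.range (f ▷ T).left = pullback.fst P.hom T.hom ⁻¹' Set.range f.left := by
  have h := Scheme.image_preimage_eq_of_isPullback (isPullback_whiskerRight_left f T).flip Set.univ
  rw [Set.preimage_univ, Set.image_univ, Set.image_univ] at h
  exact h

/-- **The square `Q ⊗ T' → P ⊗ T'` over `Q ⊗ T → P ⊗ T` is cartesian** (for `f : Q → P` and
`g : T' → T` over a base). [folklore] -/
theorem isPullback_whiskerLeft_whiskerRight_left :
    IsPullback (Q ◁ g).left (f ▷ T').left (f ▷ T).left (P ◁ g).left := by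
  refine IsPullback.of_right (h₁₂ := pullback.fst Q.hom T.hom) (v₁₃ := f.left)
    (h₂₂ := pullback.fst P.hom T.hom) ?_ ?_ (isPullback_whiskerRight_left f T).flip
  · have e₁ : (Q ◁ g).left ≫ pullback.fst Q.hom T.hom = pullback.fst Q.hom T'.hom :=
      Over.whiskerLeft_left_fst g
    have e₂ : (P ◁ g).left ≫ pullback.fst P.hom T.hom = pullback.fst P.hom T'.hom :=
      Over.whiskerLeft_left_fst g
    rw [e₁, e₂]
    exact (isPullback_whiskerRight_left f T').flip
  · change ((Q ◁ g) ≫ (f ▷ T)).left = ((f ▷ T') ≫ (P ◁ g)).left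
    rw [whisker_exchange]

/-- The range of `(Q ⊗ T').left → (P ⊗ T').left` is the preimage of the range of
`(Q ⊗ T).left → (P ⊗ T).left` under `(P ⊗ T').left → (P ⊗ T).left`. [folklore] -/
theorem range_whiskerRight_left_eq_preimage :
    Set.range (f ▷ T').left = (P ◁ g).left ⁻¹' Set.range (f ▷ T).left := by
  have h := Scheme.image_preimage_eq_of_isPullback
    (isPullback_whiskerLeft_whiskerRight_left f T g) Set.univ
  rw [Set.preimage_univ, Set.image_univ, Set.image_univ] at h
  exact h

/-- Morphisms over `X` into an object whose structure map is a monomorphism are unique.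
[folklore] -/
theorem hom_eq_of_mono_hom {Z : Over X} [Mono T.hom] (a b : Z ⟶ T) : a = b := by
  ext
  rw [← cancel_mono T.hom, Over.w a, Over.w b]

end Squares

/-! ## The stages `(P ⊗ Spec A[1/s]) ⊗ Spec B ≅ P ⊗ Spec B` -/

section Stage

variable {A : Type u} [CommRing A] (S : Submonoid A) (B : Type u) [CommRing B] [Algebra A B]
  [IsLocalization S B]

/-- The leg `Spec B → Spec A[1/s]` of the limit cone `Spec B = lim_s Spec A[1/s]`
(`LocApprox.baseCone`), as a morphism with source syntactically `specOver A B` (the cone's legs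
have source `((Functor.const _).obj _).obj s`, which is the same object only up to unfolding).
[folklore] -/
abbrev leg (s : Idx S) : specOver A B ⟶ (baseDiagram S).obj s := (baseCone S B).π.app s

variable {S} in
/-- The legs are compatible with the transition maps. [folklore] -/
@[reassoc]
theorem leg_comp_map {t s : Idx S} (ρ : t ⟶ s) : leg S B t ≫ (baseDiagram S).map ρ = leg S B s :=
  (baseCone S B).w ρ

variable (P : SchemeOver A) (s : Idx S)

/-- The canonical morphism `P ⊗ Spec B → (P ⊗ Spec A[1/s]) ⊗ Spec B` over `Spec A` (the pairing
of `P ⊗ (Spec B → Spec A[1/s])` with the projection to `Spec B`). [folklore] -/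
def toStage : P ⊗ specOver A B ⟶ (P ⊗ (baseDiagram S).obj s) ⊗ specOver A B :=
  lift (P ◁ leg S B s) (snd _ _)

/-- First component of `toStage`. [folklore] -/
@[simp]
theorem toStage_fst : toStage S B P s ≫ fst _ _ = P ◁ leg S B s := lift_fst _ _

/-- Second component of `toStage`. [folklore] -/
@[simp]
theorem toStage_snd : toStage S B P s ≫ snd _ _ = snd _ _ := lift_snd _ _

/-- `toStage` followed by the projection `(P ⊗ Spec A[1/s]) ⊗ Spec B → P ⊗ Spec B` is the
identity. [folklore] -/
theorem toStage_whiskerRight_fst :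
    toStage S B P s ≫ (fst P ((baseDiagram S).obj s) ▷ specOver A B) = 𝟙 _ := by
  refine CartesianMonoidalCategory.hom_ext _ _ ?_ ?_
  · rw [Category.assoc, whiskerRight_fst, ← Category.assoc, toStage_fst, whiskerLeft_fst,
      Category.id_comp]
  · rw [Category.assoc, whiskerRight_snd, toStage_snd, Category.id_comp]

/-- The projection `(P ⊗ Spec A[1/s]) ⊗ Spec B → P ⊗ Spec B` followed by `toStage` is the
identity: the two second components are morphisms to `Spec A[1/s]` over `Spec A`, which agree
because `Spec A[1/s] → Spec A` is a monomorphism. [folklore] -/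
theorem whiskerRight_fst_toStage :
    (fst P ((baseDiagram S).obj s) ▷ specOver A B) ≫ toStage S B P s = 𝟙 _ := by
  refine CartesianMonoidalCategory.hom_ext _ _ ?_ (by
    rw [Category.assoc, toStage_snd, whiskerRight_snd, Category.id_comp])
  rw [Category.assoc, toStage_fst, Category.id_comp]
  refine CartesianMonoidalCategory.hom_ext _ _ ?_ (hom_eq_of_mono_hom _ _ _)
  rw [Category.assoc, whiskerLeft_fst, whiskerRight_fst]

/-- **`P ⊗ Spec B ≅ (P ⊗ Spec A[1/s]) ⊗ Spec B` over `Spec A`** (`B = A_S`, `s ∈ S`): base change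
to `Spec B` does not see the intermediate restriction to the open stage `D(s) ⊇ Spec B`.
[folklore] -/
def stageIso : P ⊗ specOver A B ≅ (P ⊗ (baseDiagram S).obj s) ⊗ specOver A B where
  hom := toStage S B P s
  inv := fst P ((baseDiagram S).obj s) ▷ specOver A B
  hom_inv_id := toStage_whiskerRight_fst S B P s
  inv_hom_id := whiskerRight_fst_toStage S B P s

/-- `stageIso` unfolds to `toStage` (by `rfl`). [folklore] -/
theorem stageIso_hom : (stageIso S B P s).hom = toStage S B P s := rfl

/-- The inverse of `stageIso` is the projection (by `rfl`). [folklore] -/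
theorem stageIso_inv :
    (stageIso S B P s).inv = fst P ((baseDiagram S).obj s) ▷ specOver A B := rfl

/-- `toStage` is an isomorphism. [folklore] -/
theorem isIso_toStage : IsIso (toStage S B P s) := (stageIso S B P s).isIso_hom

variable {P} in
/-- **Naturality of `toStage` in `P`.** [folklore] -/
theorem whiskerRight_toStage {Q : SchemeOver A} (f : Q ⟶ P) :
    (f ▷ specOver A B) ≫ toStage S B P s =
      toStage S B Q s ≫ ((f ▷ (baseDiagram S).obj s) ▷ specOver A B) := by
  refine CartesianMonoidalCategory.hom_ext _ _ ?_ ?_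
  · rw [Category.assoc, toStage_fst, Category.assoc, whiskerRight_fst, ← Category.assoc,
      toStage_fst, whisker_exchange]
  · rw [Category.assoc, toStage_snd, whiskerRight_snd, Category.assoc, whiskerRight_snd,
      toStage_snd]

/-- `toStage` commutes with the projections to `Spec B`. [folklore] -/
theorem toStage_snd_left :
    (toStage S B P s).left ≫ pullback.snd _ _ = pullback.snd _ _ :=
  congrArg CommaMorphism.left (toStage_snd S B P s)

end Stage

/-! ## Quasi-compact opens of `P ×_A Spec B` come from a stage -/

section Opens

variable {A : Type u} [CommRing A] (S : Submonoid A) (B : Type u) [CommRing B] [Algebra A B]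
  [IsLocalization S B]

/-- **A quasi-compact open subset of `P ×_A Spec A_S = lim_s P ×_A Spec A[1/s]` is the preimage
of a quasi-compact open subset of some stage** (Stacks 01Z4 (1), Mathlib `exists_preimage_eq`,
for the limit cone `LocApprox.isLimitProdCone`). [cite: StacksProject, Tag 01Z4] -/
theorem exists_isCompact_preimage_eq (P : SchemeOver A)
    (O : ((P ⊗ specOver A B).left).Opens) (hO : IsCompact (O : Set (P ⊗ specOver A B).left)) :
    ∃ (s : Idx S) (O' : ((P ⊗ (baseDiagram S).obj s).left).Opens),
      IsCompact (O' : Set (P ⊗ (baseDiagram S).obj s).left) ∧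
        (P ◁ leg S B s).left ⁻¹ᵁ O' = O :=
  exists_preimage_eq (prodDiagram S P) (prodCone S B P) (isLimitProdCone S B P) O hO

variable {S} in
/-- Pulling an open subset of a stage back to a finer stage does not change its preimage in the
limit. [folklore] -/
theorem preimage_whiskerLeft_map (P : SchemeOver A) {t s : Idx S} (ρ : t ⟶ s)
    (O' : ((P ⊗ (baseDiagram S).obj s).left).Opens) :
    (P ◁ leg S B t).left ⁻¹ᵁ ((P ◁ (baseDiagram S).map ρ).left ⁻¹ᵁ O') =
      (P ◁ leg S B s).left ⁻¹ᵁ O' := by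
  rw [← Scheme.Hom.comp_preimage]
  change ((P ◁ leg S B t) ≫ (P ◁ (baseDiagram S).map ρ)).left ⁻¹ᵁ O' = _
  rw [← MonoidalCategory.whiskerLeft_comp, leg_comp_map]

variable {S} in
/-- The preimage in a finer stage of a quasi-compact open subset of a stage is quasi-compact (the
transition maps are affine). [folklore] -/
theorem isCompact_preimage_whiskerLeft_map (P : SchemeOver A) {t s : Idx S} (ρ : t ⟶ s)
    (O' : ((P ⊗ (baseDiagram S).obj s).left).Opens)
    (hO' : IsCompact (O' : Set (P ⊗ (baseDiagram S).obj s).left)) :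
    IsCompact (((P ◁ (baseDiagram S).map ρ).left ⁻¹ᵁ O' :
      ((P ⊗ (baseDiagram S).obj t).left).Opens) : Set (P ⊗ (baseDiagram S).obj t).left) :=
  QuasiCompact.isCompact_preimage (f := (P ◁ (baseDiagram S).map ρ).left) _ O'.2 hO'

/-- **Two quasi-compact opens of `P₁ ×_A Spec B`, `P₂ ×_A Spec B` come from a common stage.**
[cite: StacksProject, Tag 01Z4] -/
theorem exists_isCompact_preimage_eq₂ (P₁ P₂ : SchemeOver A)
    (O₁ : ((P₁ ⊗ specOver A B).left).Opens) (hO₁ : IsCompact (O₁ : Set (P₁ ⊗ specOver A B).left))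
    (O₂ : ((P₂ ⊗ specOver A B).left).Opens) (hO₂ : IsCompact (O₂ : Set (P₂ ⊗ specOver A B).left)) :
    ∃ (s : Idx S) (O₁' : ((P₁ ⊗ (baseDiagram S).obj s).left).Opens)
      (O₂' : ((P₂ ⊗ (baseDiagram S).obj s).left).Opens),
      IsCompact (O₁' : Set (P₁ ⊗ (baseDiagram S).obj s).left) ∧
        IsCompact (O₂' : Set (P₂ ⊗ (baseDiagram S).obj s).left) ∧
        (P₁ ◁ leg S B s).left ⁻¹ᵁ O₁' = O₁ ∧ (P₂ ◁ leg S B s).left ⁻¹ᵁ O₂' = O₂ := by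
  obtain ⟨s₁, O₁', h₁, e₁⟩ := exists_isCompact_preimage_eq S B P₁ O₁ hO₁
  obtain ⟨s₂, O₂', h₂, e₂⟩ := exists_isCompact_preimage_eq S B P₂ O₂ hO₂
  obtain ⟨s, ⟨ρ₁⟩, ⟨ρ₂⟩⟩ := exists_hom₂ S s₁ s₂
  refine ⟨s, (P₁ ◁ (baseDiagram S).map ρ₁).left ⁻¹ᵁ O₁', (P₂ ◁ (baseDiagram S).map ρ₂).left ⁻¹ᵁ O₂',
    isCompact_preimage_whiskerLeft_map P₁ ρ₁ O₁' h₁, isCompact_preimage_whiskerLeft_map P₂ ρ₂ O₂' h₂,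
    ?_, ?_⟩
  · rw [preimage_whiskerLeft_map B P₁ ρ₁ O₁', e₁]
  · rw [preimage_whiskerLeft_map B P₂ ρ₂ O₂', e₂]

end Opens

end LocApprox

end Literature.AlgebraicGeometry.Limits

end
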